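import Summits.RiemannHypothesis.RiemannHypothesis.Theorems.TiltedLandingLaw421R3RateGlue2A

/-!
# RUNG-P (lens-2 g5, O5-f (CA624)) — C′'s perturbative rung, window split, located Newton door, composition TYPED (HELD; 0 sorry)
RUNG-P := `TouchedDissipationLawQ (5/2) 30` (C′'s own population; the floor binder `κ₀ ≤ λ = Im v·κ_v` IS the perturbative parameter; `c₁ = 5/2`,
`Λ₀ = 30`): `rungP_of_drop` — «X ≥ 3 − C/λ» with any `C ≤ 15` gives it; honest `C = 4·Im v²·M·(1+O(1/λ))`, `M` (Lipschitz constant of the cofactor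
field on the Newton disc) ≤ partner `1/(2Im v − r)²` + mate `2/((3/2)Im v − r)²` + zoo `Σ 2/(‖v−u‖ − r)²` + lateral-far `(η/s)/(R/2 − hmax)`, `r = (1+ρ₀)/‖K‖`.
§0 objects + C′ VERBATIM from `TouchedDissipation-v3opt.lean` (bfd0f370), coexistence copy under this namespace; `BetaLevel` bundles C′'s five level
binders (new Props only).  §1 `RungP`, window law, ★ `lawQ_of_rungP_of_window` (split literally true).  §2 ★ `SecondOrderNewtonDoorQ` = the LOCATED
door (same hypotheses as the tree's `RhW08.NewtonDoor.succ_of_newton_door` ∘ `fieldVariation_of_lipschitz`, which export only `∃ StTrkDQ (j+1) u`;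
the location is the new content; second order = `ρ₀ ≈ C₀/λ²`) — K-1 kernel target.  §3 `LipschitzBudgetQ`, `ChildEnergyTwoQ` (W1-type, token 23),
`PerturbativeDropQ`, ★ `rungP_of_drop`, HELD glue target `DropFromDoorQ` (Prop).  Nothing here bears on the truth of RH; RH is not proved; RUNG-P is a
CANDIDATE, not a theorem; C′/T″ typed not proved; ★A / 33346 / 33347 OPEN; checked ≠ landed ≠ proved. -/

namespace RhW08.PerturbativeRung

open Complex RhW08.Round1 RhW08.StSwap RhW08.Round2 RhW08.QuadW RhW08.SealSwapQ RhW08.RateSplit RhW08.BurgersRate RhW08.BurgersRateG3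
open RhW08.SealSwap (PBot)
open RhW08.AntiEscapeSplit7 RhIdea6.G17.W07C7 RhIdea6.G17.W07C7.Rev6 RhIdea6.G18.W07C8.Law421BirthS RhIdea6.G19.W07C11.Seam RhIdea6.G20.W07C12.Frac
open RhIdea6.G20.W07C12.StColP RhW07.C12.FieldSplit RhIdea6.G21.W07C13.TentMax RhW07.C14.TwoSided RhW07.C14.Classes RhW07.C14.Lineage RhW07.C14.Booking

/-! ## §0 Objects and C′ (verbatim bodies from `TouchedDissipation-v3opt.lean` §1–§2) -/
/-- §0 (verbatim) the TOUCH relation. -/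
def Touches (f : ℂ → ℂ) (j : ℕ) (v z : ℂ) : Prop :=
  iteratedDeriv j f z = 0 ∧ v.im < z.im ∧ |v.re - z.re| ≤ v.im + z.im

/-- §0 (verbatim) the ATOMIC pair. -/
def AtomicPair (f : ℂ → ℂ) (j : ℕ) (v z : ℂ) : Prop :=
  ∀ u : ℂ, iteratedDeriv j f u = 0 → 0 < u.im → u ≠ v → u ≠ z → v.im + u.im < |v.re - u.re| ∧ z.im + u.im < |z.re - u.re|

/-- §0 (verbatim) `Ū = D̄_v ∪ D̄_z`. -/
def pairUnion (v z : ℂ) : Set ℂ :=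
  {u : ℂ | ‖u - (v.re : ℂ)‖ ≤ v.im ∨ ‖u - (z.re : ℂ)‖ ≤ z.im}

/-- §0 (verbatim) the multiplicity-weighted energy of the upper children off `Z(f⁽ʲ⁾)` in `S`. -/
noncomputable def childEnergy (f : ℂ → ℂ) (j : ℕ) (S : Set ℂ) : ℝ :=
  ∑ᶠ u ∈ {u : ℂ | (iteratedDeriv (j + 1) f u = 0 ∧ iteratedDeriv j f u ≠ 0 ∧ u ∈ S) ∧ 0 < u.im},
    (analyticOrderNatAt (iteratedDeriv (j + 1) f) u : ℝ) * u.im ^ 2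

/-- §0 (verbatim) `κ_v := ‖tiltAt f j v‖`. -/
noncomputable def stateKappa (f : ℂ → ℂ) (j : ℕ) (v : ℂ) : ℝ := ‖tiltAt f j v‖

/-- §0 (verbatim) C′ = `TouchedDissipationLawQ c κ₀`. -/
def TouchedDissipationLawQ (c κ₀ : ℝ) : Prop :=
  ∀ (η : ℝ) (f : ℂ → ℂ) (x₀ s hmax R Hs : ℝ) (B : ℕ), EngineHyps5 2 η f x₀ s hmax R Hs B →
    ∀ (j : ℕ) (v z : ℂ), Charged (PTrkSQ PBot) StTrkDQ ReadyR2 η f x₀ s hmax R Hs B j → ApproachLevelQ η f x₀ s hmax R Hs B j →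
      IsLowest StTrkDQ η f x₀ s hmax R Hs B j v → Touches f j v z → AtomicPair f j v z →
      κ₀ ≤ v.im * stateKappa f j v →
      c ≤ ((v.im ^ 2 + z.im ^ 2) - childEnergy f j (pairUnion v z)) * stateKappa f j v ^ 2

/-- C′'s five LEVEL BINDERS bundled (charged approach level `j`, lowest state `v` touched by `z`, the pair atomic) — used by the NEW Props only. -/
def BetaLevel (η : ℝ) (f : ℂ → ℂ) (x₀ s hmax R Hs : ℝ) (B j : ℕ) (v z : ℂ) : Prop :=
  Charged (PTrkSQ PBot) StTrkDQ ReadyR2 η f x₀ s hmax R Hs B j ∧ ApproachLevelQ η f x₀ s hmax R Hs B j ∧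
    IsLowest StTrkDQ η f x₀ s hmax R Hs B j v ∧ Touches f j v z ∧ AtomicPair f j v z

/-! ## §1 RUNG-P and the window split -/

/-- (i) ★ RUNG-P(30) := C′ with `c₁ = 5/2` above the floor `Λ₀ = 30` — the perturbative rung (theorem CANDIDATE). -/
def RungP : Prop := TouchedDissipationLawQ (5 / 2) 30

/-- (ii) the WINDOW variant of C′: the same population restricted to `κ₀ ≤ λ < κ₁` (`λ = Im v·κ_v`). -/
def TouchedDissipationLawQ₂ (c κ₀ κ₁ : ℝ) : Prop :=
  ∀ (η : ℝ) (f : ℂ → ℂ) (x₀ s hmax R Hs : ℝ) (B : ℕ), EngineHyps5 2 η f x₀ s hmax R Hs B → ∀ (j : ℕ) (v z : ℂ), BetaLevel η f x₀ s hmax R Hs B j v z →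
      κ₀ ≤ v.im * stateKappa f j v → v.im * stateKappa f j v < κ₁ →
      c ≤ ((v.im ^ 2 + z.im ^ 2) - childEnergy f j (pairUnion v z)) * stateKappa f j v ^ 2

/-- ★ (ii) THE SPLIT IS LITERALLY TRUE: RUNG-P (`λ ≥ 30`) and the window law C′(3/2) on `3 ≤ λ < 30` give C′(3/2, 3) (case on `λ < 30`). -/
theorem lawQ_of_rungP_of_window (hP : RungP) (hW : TouchedDissipationLawQ₂ (3 / 2) 3 30) : TouchedDissipationLawQ (3 / 2) 3 := by
  intro η f x₀ s hmax R Hs B hE j v z hch hA hlow ht ha hfl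
  by_cases hlt : v.im * stateKappa f j v < 30
  · exact hW η f x₀ s hmax R Hs B hE j v z ⟨hch, hA, hlow, ht, ha⟩ hfl hlt
  · have h := hP η f x₀ s hmax R Hs B hE j v z hch hA hlow ht ha (not_lt.1 hlt)
    linarith

/-! ## §2 The second-order (located) Newton door — K-1 -/

/-- (iii) ★ the LOCATED NEWTON DOOR (classical Rouché vs the linear model, Lipschitz form; hypotheses = the tree's `succ_of_newton_door` ∘
`fieldVariation_of_lipschitz`): `F = (· − v)·h`, `K ≠ 0`, `0 < ρ₀`, `h ≠ 0` on the closed Newton disc `‖u − (v − K⁻¹)‖ ≤ ρ₀/‖K‖`, field `Λ`-close to `K`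
on the Newton circle with `(1+ρ₀)Λ < ρ₀‖K‖` ⇒ a zero `u` of `F′` with `h u ≠ 0` (a MOVING child) INSIDE the disc.  Second order: `ρ₀ = C₀/λ²`.  K-1 target. -/
def SecondOrderNewtonDoorQ : Prop :=
  ∀ (F h : ℂ → ℂ) (v K : ℂ) (ρ₀ Λ : ℝ), Differentiable ℂ F → Differentiable ℂ h → (∀ u : ℂ, F u = (u - v) * h u) → K ≠ 0 → 0 < ρ₀ →
    (1 + ρ₀) * Λ < ρ₀ * ‖K‖ →
    (∀ u : ℂ, ‖u - (v - K⁻¹)‖ ≤ ρ₀ / ‖K‖ → h u ≠ 0) →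
    (∀ u : ℂ, ‖u - (v - K⁻¹)‖ = ρ₀ / ‖K‖ → ‖deriv h u / h u - K‖ ≤ Λ) →
    ∃ u : ℂ, ‖u - (v - K⁻¹)‖ < ρ₀ / ‖K‖ ∧ deriv F u = 0 ∧ h u ≠ 0

/-! ## §3 The composition, typed -/

/-- the second-order Newton radius parameter at `w`: `ρ₀(w) := C₀/λ_K(w)²`, `λ_K = Im w·‖newtonK f j w‖`. -/
noncomputable def rho0 (C₀ : ℝ) (f : ℂ → ℂ) (j : ℕ) (w : ℂ) : ℝ := C₀ / (w.im * ‖newtonK f j w‖) ^ 2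

/-- (iv-a) at every β-level above the floor 30 the door's analytic data are VALID at `v` and at its mate `z` with `ρ₀ = rho0 C₀` and
`Λ = ρ₀‖K‖/(2(1+ρ₀))` (cofactor zero-free on the closed Newton disc; field `Λ`-close to `K_w = newtonK f j w` on the circle; budget for `M` in the header). -/
def LipschitzBudgetQ (C₀ : ℝ) : Prop :=
  ∀ (η : ℝ) (f : ℂ → ℂ) (x₀ s hmax R Hs : ℝ) (B : ℕ), EngineHyps5 2 η f x₀ s hmax R Hs B → ∀ (j : ℕ) (v z : ℂ), BetaLevel η f x₀ s hmax R Hs B j v z → 30 ≤ v.im * stateKappa f j v →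
      ∀ w : ℂ, (w = v ∨ w = z) →
        newtonK f j w ≠ 0 ∧ 0 < rho0 C₀ f j w ∧
        (∀ u : ℂ, ‖u - (w - (newtonK f j w)⁻¹)‖ ≤ rho0 C₀ f j w / ‖newtonK f j w‖ → dslope (iteratedDeriv j f) w u ≠ 0) ∧
        (∀ u : ℂ, ‖u - (w - (newtonK f j w)⁻¹)‖ = rho0 C₀ f j w / ‖newtonK f j w‖ →
          ‖deriv (dslope (iteratedDeriv j f) w) u / dslope (iteratedDeriv j f) w u - newtonK f j w‖ ≤
            rho0 C₀ f j w * ‖newtonK f j w‖ / (2 * (1 + rho0 C₀ f j w)))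

/-- (iv-b) W1-type (token 23's count `P = 2` + `child_mem_disc`): moving children located in the two Newton discs carry the WHOLE child energy of `Ū`. -/
def ChildEnergyTwoQ (C₀ : ℝ) : Prop :=
  ∀ (η : ℝ) (f : ℂ → ℂ) (x₀ s hmax R Hs : ℝ) (B : ℕ), EngineHyps5 2 η f x₀ s hmax R Hs B → ∀ (j : ℕ) (v z : ℂ), BetaLevel η f x₀ s hmax R Hs B j v z → 30 ≤ v.im * stateKappa f j v →
      ∀ u₁ u₂ : ℂ, iteratedDeriv (j + 1) f u₁ = 0 → iteratedDeriv j f u₁ ≠ 0 → iteratedDeriv (j + 1) f u₂ = 0 → iteratedDeriv j f u₂ ≠ 0 →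
        ‖u₁ - (v - (newtonK f j v)⁻¹)‖ < rho0 C₀ f j v / ‖newtonK f j v‖ → ‖u₂ - (z - (newtonK f j z)⁻¹)‖ < rho0 C₀ f j z / ‖newtonK f j z‖ →
        childEnergy f j (pairUnion v z) = u₁.im ^ 2 + u₂.im ^ 2

/-- (iv-c) the perturbative dissipation estimate «X ≥ 3 − C/λ» on β-levels above the floor 3. -/
def PerturbativeDropQ (C : ℝ) : Prop :=
  ∀ (η : ℝ) (f : ℂ → ℂ) (x₀ s hmax R Hs : ℝ) (B : ℕ), EngineHyps5 2 η f x₀ s hmax R Hs B → ∀ (j : ℕ) (v z : ℂ), BetaLevel η f x₀ s hmax R Hs B j v z → 3 ≤ v.im * stateKappa f j v →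
      3 - C / (v.im * stateKappa f j v) ≤ ((v.im ^ 2 + z.im ^ 2) - childEnergy f j (pairUnion v z)) * stateKappa f j v ^ 2

/-- ★ (iv) RUNG-P FROM THE DROP: any `C ≤ 15` gives `3 − C/λ ≥ 5/2` on `λ ≥ 30`. -/
theorem rungP_of_drop {C : ℝ} (hC : C ≤ 15) (hD : PerturbativeDropQ C) : RungP := by
  intro η f x₀ s hmax R Hs B hE j v z hch hA hlow ht ha hfl
  have h := hD η f x₀ s hmax R Hs B hE j v z ⟨hch, hA, hlow, ht, ha⟩ (by linarith)
  have hl : (0 : ℝ) < v.im * stateKappa f j v := by linarith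
  have hq : C / (v.im * stateKappa f j v) ≤ 1 / 2 := by
    rw [div_le_iff₀ hl]; linarith
  linarith

/-- (iv-d) the HELD GLUE TARGET (a Prop, unproved): door + budget + two-children ⟹ drop; proof = `Im u_w = Im w + Im K_w/‖K_w‖² + O(ρ₀/‖K_w‖)`,
`Im K_w = −1/(2Im w) + pulls` (kernel `UncoveredSign`), `LeadingDissipation.leading_ge_three_of_touch`; then `rungP_of_drop`. -/
def DropFromDoorQ (C₀ C : ℝ) : Prop := SecondOrderNewtonDoorQ → LipschitzBudgetQ C₀ → ChildEnergyTwoQ C₀ → PerturbativeDropQ C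

end RhW08.PerturbativeRung
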